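import Literature.AlgebraicGeometry.Hu2025.Proofs.S03Pluecker.Prop36
import HarnessLib

/-!
# Hu 2025 — the Γ-scheme of the COMPLETE QUADRILATERAL on the typed chart `𝕌 = (p₁₂₃ ≡ 1)` of `Gr(3,9)` is NOT INTEGRAL:
# a kernel zero-divisor certificate over the row-101 platform (evidence for joint J1 = GAP-LEDGER-HU row HU-R01)

**HONEST FRAMING (D-0012/D-0089).** [Hu2025] (arXiv:2507.21400v1) is an unrefereed preprint under adjudication; nothing of it is
asserted here. This file proves theorems about OUR typed objects of `Statements/S03Pluecker/R101aPlatform.lean` ·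
`R101bPrimary.lean` (typer res-type-009): the chart ring `k[x_u]` (`ChartRing`), the de-homogenised m-primary family `𝓕_m`
(`primaryFamily`), the chart variables `x̄_u` (`xbar`), the universal point `[I₃ | A]` (`chartParam`, `chartMinor`, `bvar`). The
joint J1 (PARTITION-HU §4; GAP-LEDGER-HU row HU-R01) asks whether the printed inference «X integral ⇒ Z_Γ integral» ([Hu22] p.131
l.40–41; [Hu25] Thm 8.5 / 8.6 / 1.3 HYPOTHESIS «Assume that Z_Γ is integral», Def 7.1 `Z_Γ := 𝕌 ∩ Gr^{3,E} ∩ {x_u = 0, u ∈ Γ}`)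
holds. The tree certificate `Literature/AlgebraicGeometry/Hu2025/GammaSchemeNotIntegral.lean` (prior cell) gives the complete-
quadrilateral counter-configuration by exact point evaluations + a Jacobian rank and argues the geometry in prose. THIS FILE makes the
conclusion a KERNEL statement about the typed chart: for every `n ≥ 9` and `Γ = {456, 478, 579, 689}` (the four lines of a complete
quadrilateral on the six points `4,…,9`), the ring `k[x_u]_{u ∈ 𝕀_{3,n} ∖ m} ⧸ ((𝓕_m) + (x_u : u ∈ Γ))` — the coordinate ring of
`Z_Γ` read on the chart at ring level (Def 7.1; row 109 types `Z_Γ` itself, a one-line bridge identifies its ideal with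
`gammaChartIdeal` once that file lands) — is NOT a domain, over EVERY nontrivial commutative ring `k` (all characteristics).
Whether the matroid Schubert cell side («X integral») holds for this Γ is the prose part of the tree certificate (Gr_d is an open
subset of Z_Γ consisting of honest quadrilaterals; d connected) and is NOT re-proved here. AI proof is weaker than expert review;
nothing here is progress on resolution of singularities; no claim beyond the kernel.

## The certificate (found by a 49-unknown linear solve over ℤ, folder work/J1/cert_search2.py of res-type-009 g6; checked here by `ring`)
Write `a_j = (x_{23j}, −x_{13j}, x_{12j})` for column `j > 3` of `[I₃ | A]` (row-101b convention `chartCol`), so that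
`chartMinor (u₁,u₂,u₃) = det(a_{u₁}, a_{u₂}, a_{u₃})`. Let `f := chartMinor (4,5,7)` (a minor NOT in Γ) and let `g` be the
QUADRANGULAR-SET (INVOLUTION) DETERMINANT of the projections `(x_{23j} : −x_{13j})` of the three pairs of opposite vertices
`(4,9), (5,8), (6,7)` to `ℙ¹` (forgetting the third coordinate): `g = det` of the `3 × 3` matrix of coefficients of the binary
quadrics `(y₄X − x₄Y)(y₉X − x₉Y)`, `(y₅X − x₅Y)(y₈X − x₈Y)`, `(y₆X − x₆Y)(y₇X − x₇Y)` (classical: the three pairs of opposite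
vertices of a complete quadrilateral are seen from any point in three pairs of an involution — so `g` vanishes on quadrilateral
configurations; it does not vanish on the coplanar locus `rank A ≤ 2`, on which every minor vanishes). Then, as polynomials in the
18 basic variables, `f · g = c₁·det(a₄,a₅,a₆) + c₂·det(a₄,a₇,a₈) + c₃·det(a₅,a₇,a₉) + c₄·det(a₆,a₈,a₉)` with the explicit
integer sextics `c₁,…,c₄` below (`quad_certificate`); `f ∉ I_Γ` (the quadrilateral point `Q`, `f(Q) = 1`) and `g ∉ I_Γ` (the
coplanar point `P`, `g(P) = 1`) by evaluation (`1 ≠ 0` in a nontrivial ring — no characteristic hypothesis). Transfer to the chart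
ring `k[x_u]` is by row 101b's `chartParam` (kernel `= (𝓕_m)`, `Proofs/S03Pluecker/Prop36.lean`): `F ∈ (𝓕_m) + (x̄_u : u ∈ Γ) ↔
chartParam F ∈ (chartMinor u : u ∈ Γ)` (`mem_gammaChartIdeal_iff`).

## Contents
§1 `gammaChartIdeal`, `gammaMinorIdeal` and the transfer lemma · §2 the quadrilateral `Γ`, the certificate polynomials and the
identity · §3 the two evaluation points · §4 `not_isPrime_gammaChartIdeal_quad`, `not_isDomain_gammaChart_quad`.
-/

noncomputable section

namespace Literature.AlgebraicGeometry.Hu2025.Statements.S03Pluecker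

open MvPolynomial

universe u

variable (k : Type u) [CommRing k]

/-! ## §1 The Γ-ideal on the typed chart and its image in `k[Var_𝕌]` -/

/-- **The Γ-ideal of the chart ring**, `(𝓕_m) + (x̄_u : u ∈ Γ) ⊂ k[x_u]_{u ∈ 𝕀_{3,n} ∖ m}`: the ring-level reading, on the typed
row-101 chart, of Hu's `Z_Γ = 𝕌 ∩ Gr^{3,E} ∩ {x_u = 0 : u ∈ Γ}` (Def 7.1, chunk p0057 l.9; `𝕌 ∩ Gr^{3,E}` is cut out by `𝓕_m`,
Prop 3.6). OURS bookkeeping (row 109 owns Def 7.1's own decl). [claim: Hu2025, status: under-review] -/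
def gammaChartIdeal (n : ℕ) (Γ : Set (ℕ × ℕ × ℕ)) : Ideal (ChartRing n k) :=
  Ideal.span (primaryFamily n k) ⊔ Ideal.span ((fun u => (xbar k u : ChartRing n k)) '' Γ)

/-- The image of the Γ-ideal on the universal point `[I₃ | A]`: `(chartMinor u : u ∈ Γ) ⊂ k[Var_𝕌]`. OURS bookkeeping.
[cite: Hu2025, Def. 7.1 (Γ-scheme Z_Γ, I_{℘,Γ}), p.128; Prop. 3.6 p.38; joint J1 = GAP-LEDGER-HU row HU-R01 (unrefereed preprint arXiv:2507.21400v1 under adjudication, D-0012/D-0089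
— kernel support on OUR typed carriers of row 101; nothing of the source asserted)] -/
def gammaMinorIdeal (n : ℕ) (Γ : Set (ℕ × ℕ × ℕ)) : Ideal (BasicRing n k) :=
  Ideal.span ((fun u => (chartMinor k u : BasicRing n k)) '' Γ)

variable {n : ℕ} {Γ : Set (ℕ × ℕ × ℕ)}

/-- `(𝓕_m) + (x̄_Γ) ⊆ chartParam⁻¹ (minors of Γ)`.
[cite: Hu2025, Def. 7.1 (Γ-scheme Z_Γ, I_{℘,Γ}), p.128; Prop. 3.6 p.38; joint J1 = GAP-LEDGER-HU row HU-R01 (unrefereed preprint arXiv:2507.21400v1 under adjudication, D-0012/D-0089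
— kernel support on OUR typed carriers of row 101; nothing of the source asserted)] -/
theorem gammaChartIdeal_le_comap (hΓ : Γ ⊆ plVarSet n) :
    gammaChartIdeal k n Γ ≤ (gammaMinorIdeal k n Γ).comap (chartParam n k) := by
  refine sup_le ?_ ?_
  · intro F hF
    have h0 : chartParam n k F = 0 := by
      have h := span_primaryFamily_le_ker k hF
      rwa [RingHom.mem_ker] at h
    rw [Ideal.mem_comap, h0]
    exact Ideal.zero_mem _
  · rw [Ideal.span_le]
    rintro _ ⟨u, hu, rfl⟩
    rw [SetLike.mem_coe, Ideal.mem_comap, chartParam_xbar k (hΓ hu)]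
    exact Ideal.subset_span ⟨u, hu, rfl⟩

/-- `basicIncl (minors of Γ) ⊆ (𝓕_m) + (x̄_Γ)` (since `basicIncl (chartParam x̄_u) ≡ x̄_u mod (𝓕_m)`).
[cite: Hu2025, Def. 7.1 (Γ-scheme Z_Γ, I_{℘,Γ}), p.128; Prop. 3.6 p.38; joint J1 = GAP-LEDGER-HU row HU-R01 (unrefereed preprint arXiv:2507.21400v1 under adjudication, D-0012/D-0089
— kernel support on OUR typed carriers of row 101; nothing of the source asserted)] -/
theorem map_basicIncl_gammaMinorIdeal_le (hΓ : Γ ⊆ plVarSet n) :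
    (gammaMinorIdeal k n Γ).map (basicIncl n k) ≤ gammaChartIdeal k n Γ := by
  unfold gammaMinorIdeal
  rw [Ideal.map_span, Ideal.span_le]
  rintro _ ⟨_, ⟨u, hu, rfl⟩, rfl⟩
  have h1 : xbar k u - basicIncl n k (chartParam n k (xbar k u)) ∈ Ideal.span (primaryFamily n k) :=
    sub_incl_chartParam_mem k _
  rw [chartParam_xbar k (hΓ hu)] at h1
  have h2 : (xbar k u : ChartRing n k) ∈ gammaChartIdeal k n Γ :=
    Ideal.mem_sup_right (Ideal.subset_span ⟨u, hu, rfl⟩)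
  have h3 : xbar k u - basicIncl n k (chartMinor k u) ∈ gammaChartIdeal k n Γ := Ideal.mem_sup_left h1
  have h4 := Ideal.sub_mem _ h2 h3
  rwa [sub_sub_cancel] at h4

/-- **Transfer lemma**: `F ∈ (𝓕_m) + (x̄_u : u ∈ Γ) ↔ chartParam F ∈ (chartMinor u : u ∈ Γ)` (uses `ker chartParam ⊇ (𝓕_m)` and
`F ≡ basicIncl (chartParam F) mod (𝓕_m)` from `Proofs/S03Pluecker/Prop36.lean`).
[cite: Hu2025, Def. 7.1 (Γ-scheme Z_Γ, I_{℘,Γ}), p.128; Prop. 3.6 p.38; joint J1 = GAP-LEDGER-HU row HU-R01 (unrefereed preprint arXiv:2507.21400v1 under adjudication, D-0012/D-0089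
— kernel support on OUR typed carriers of row 101; nothing of the source asserted)] -/
theorem mem_gammaChartIdeal_iff (hΓ : Γ ⊆ plVarSet n) (F : ChartRing n k) :
    F ∈ gammaChartIdeal k n Γ ↔ chartParam n k F ∈ gammaMinorIdeal k n Γ := by
  constructor
  · intro h
    exact (Ideal.mem_comap.mp (gammaChartIdeal_le_comap k hΓ h))
  · intro h
    have h1 : F - basicIncl n k (chartParam n k F) ∈ gammaChartIdeal k n Γ :=
      Ideal.mem_sup_left (sub_incl_chartParam_mem k F)
    have h2 : basicIncl n k (chartParam n k F) ∈ gammaChartIdeal k n Γ :=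
      map_basicIncl_gammaMinorIdeal_le k hΓ (Ideal.mem_map_of_mem _ h)
    have h3 := Ideal.add_mem _ h1 h2
    rwa [sub_add_cancel] at h3

/-- Non-membership in a span by evaluation: a ring hom killing the generators but not `f`.
[cite: Hu2025, Def. 7.1 (Γ-scheme Z_Γ, I_{℘,Γ}), p.128; Prop. 3.6 p.38; joint J1 = GAP-LEDGER-HU row HU-R01 (unrefereed preprint arXiv:2507.21400v1 under adjudication, D-0012/D-0089
— kernel support on OUR typed carriers of row 101; nothing of the source asserted)] -/
theorem not_mem_span_of_eval {R S : Type*} [CommRing R] [CommRing S] (φ : R →+* S) {s : Set R}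
    (hs : ∀ x ∈ s, φ x = 0) {f : R} (hf : φ f ≠ 0) : f ∉ Ideal.span s := by
  intro h
  apply hf
  have hle : Ideal.span s ≤ RingHom.ker φ := by
    rw [Ideal.span_le]
    intro x hx
    rw [SetLike.mem_coe, RingHom.mem_ker]
    exact hs x hx
  exact RingHom.mem_ker.mp (hle h)

/-! ## §2 The complete quadrilateral: `Γ = {456, 478, 579, 689}` (any `n ≥ 9`), and the certificate -/

/-- **`Γ` of the complete quadrilateral** on the points `4,…,9`: lines `{4,5,6}, {4,7,8}, {5,7,9}, {6,8,9}` (`4 = L₁L₂, 5 = L₁L₃,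
6 = L₁L₄, 7 = L₂L₃, 8 = L₂L₄, 9 = L₃L₄`; opposite vertices `(4,9), (5,8), (6,7)`) — the `Γ = Γ_d` of the tree certificate
`Hu2025/GammaSchemeNotIntegral.lean` (there 0-based). OURS.
[cite: Hu2025, Def. 7.1 (Γ-scheme Z_Γ, I_{℘,Γ}), p.128; Prop. 3.6 p.38; joint J1 = GAP-LEDGER-HU row HU-R01 (unrefereed preprint arXiv:2507.21400v1 under adjudication, D-0012/D-0089
— kernel support on OUR typed carriers of row 101; nothing of the source asserted)] -/
def quadGamma : Set (ℕ × ℕ × ℕ) := {(4, 5, 6), (4, 7, 8), (5, 7, 9), (6, 8, 9)}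

/-- `Γ ⊆ 𝕀_{3,n} ∖ m` for `n ≥ 9`.
[cite: Hu2025, Def. 7.1 (Γ-scheme Z_Γ, I_{℘,Γ}), p.128; Prop. 3.6 p.38; joint J1 = GAP-LEDGER-HU row HU-R01 (unrefereed preprint arXiv:2507.21400v1 under adjudication, D-0012/D-0089
— kernel support on OUR typed carriers of row 101; nothing of the source asserted)] -/
theorem quadGamma_subset (hn : 9 ≤ n) : quadGamma ⊆ plVarSet n := by
  intro u hu
  simp only [quadGamma, Set.mem_insert_iff, Set.mem_singleton_iff] at hu
  rcases hu with rfl | rfl | rfl | rfl <;>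
    exact mem_plVarSet (by norm_num) (by norm_num) (by norm_num) (by omega) (by norm_num)

/-- A `3 × 3` minor of `[I₃ | A]` on three columns `a, b, c > 3`, fully expanded in the basic variables (from row 101b's
`chartMinor_abc`, `chartMinor_1bc/2bc/3bc`).
[cite: Hu2025, Def. 7.1 (Γ-scheme Z_Γ, I_{℘,Γ}), p.128; Prop. 3.6 p.38; joint J1 = GAP-LEDGER-HU row HU-R01 (unrefereed preprint arXiv:2507.21400v1 under adjudication, D-0012/D-0089
— kernel support on OUR typed carriers of row 101; nothing of the source asserted)] -/
theorem chartMinor_explicit {a b c : ℕ} (ha : 3 < a) (hb : 3 < b) (hc : 3 < c) :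
    (chartMinor k (a, b, c) : BasicRing n k) =
      bvar k (1, 2, a) * (bvar k (1, 3, b) * bvar k (2, 3, c) - bvar k (2, 3, b) * bvar k (1, 3, c))
        - bvar k (1, 3, a) * (bvar k (1, 2, b) * bvar k (2, 3, c) - bvar k (2, 3, b) * bvar k (1, 2, c))
        + bvar k (2, 3, a) * (bvar k (1, 2, b) * bvar k (1, 3, c) - bvar k (1, 3, b) * bvar k (1, 2, c)) := by
  rw [chartMinor_abc k ha hb hc, chartMinor_3bc k hb hc, chartMinor_2bc k hb hc, chartMinor_1bc k hb hc]

/-- **`g`, the quadrangular-set (involution) determinant** of the pairs of opposite vertices `(4,9), (5,8), (6,7)` projected to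
`(x_{23j} : −x_{13j}) ∈ ℙ¹`: `det [[y₄y₉, −(y₄x₉ + x₄y₉), x₄x₉], [y₅y₈, …], [y₆y₇, …]]` with `x_j = x_{23j}`, `y_j = −x_{13j}`,
expanded (12 terms; a sextic in the twelve variables `x_{13j}, x_{23j}` only — hence NOT in the ideal of `3 × 3` minors). Typed in
`k[Var_𝕌]` for any `n` (meaningful for `n ≥ 9`). OURS.
[cite: Hu2025, Def. 7.1 (Γ-scheme Z_Γ, I_{℘,Γ}), p.128; Prop. 3.6 p.38; joint J1 = GAP-LEDGER-HU row HU-R01 (unrefereed preprint arXiv:2507.21400v1 under adjudication, D-0012/D-0089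
— kernel support on OUR typed carriers of row 101; nothing of the source asserted)] -/
def quadInvolutionDet (n : ℕ) : BasicRing n k :=
    bvar k (1, 3, 6) * bvar k (1, 3, 7) * bvar k (1, 3, 9) * bvar k (2, 3, 4) * bvar k (2, 3, 5) * bvar k (2, 3, 8)
      - bvar k (1, 3, 6) * bvar k (1, 3, 7) * bvar k (1, 3, 8) * bvar k (2, 3, 4) * bvar k (2, 3, 5) * bvar k (2, 3, 9)
      - bvar k (1, 3, 5) * bvar k (1, 3, 8) * bvar k (1, 3, 9) * bvar k (2, 3, 4) * bvar k (2, 3, 6) * bvar k (2, 3, 7)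
      + bvar k (1, 3, 5) * bvar k (1, 3, 7) * bvar k (1, 3, 8) * bvar k (2, 3, 4) * bvar k (2, 3, 6) * bvar k (2, 3, 9)
      + bvar k (1, 3, 5) * bvar k (1, 3, 6) * bvar k (1, 3, 8) * bvar k (2, 3, 4) * bvar k (2, 3, 7) * bvar k (2, 3, 9)
      - bvar k (1, 3, 5) * bvar k (1, 3, 6) * bvar k (1, 3, 7) * bvar k (2, 3, 4) * bvar k (2, 3, 8) * bvar k (2, 3, 9)
      + bvar k (1, 3, 4) * bvar k (1, 3, 8) * bvar k (1, 3, 9) * bvar k (2, 3, 5) * bvar k (2, 3, 6) * bvar k (2, 3, 7)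
      - bvar k (1, 3, 4) * bvar k (1, 3, 7) * bvar k (1, 3, 9) * bvar k (2, 3, 5) * bvar k (2, 3, 6) * bvar k (2, 3, 8)
      - bvar k (1, 3, 4) * bvar k (1, 3, 6) * bvar k (1, 3, 9) * bvar k (2, 3, 5) * bvar k (2, 3, 7) * bvar k (2, 3, 8)
      + bvar k (1, 3, 4) * bvar k (1, 3, 6) * bvar k (1, 3, 7) * bvar k (2, 3, 5) * bvar k (2, 3, 8) * bvar k (2, 3, 9)
      + bvar k (1, 3, 4) * bvar k (1, 3, 5) * bvar k (1, 3, 9) * bvar k (2, 3, 6) * bvar k (2, 3, 7) * bvar k (2, 3, 8)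
      - bvar k (1, 3, 4) * bvar k (1, 3, 5) * bvar k (1, 3, 8) * bvar k (2, 3, 6) * bvar k (2, 3, 7) * bvar k (2, 3, 9)

/-- **`g` IS the involution determinant**: with `x_j := x_{23j}`, `y_j := −x_{13j}` (the first two coordinates of column `j` of
`[I₃ | A]`), `g = det` of the coefficient matrix of the three binary quadrics `(y_iX − x_iY)(y_jX − x_jY) = y_iy_j X² − (y_ix_j + x_iy_j) XY
+ x_ix_j Y²` for the opposite-vertex pairs `(i,j) = (4,9), (5,8), (6,7)` (three point-pairs of `ℙ¹` are pairs of one involution iff these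
quadrics are linearly dependent).
[cite: Hu2025, Def. 7.1 (Γ-scheme Z_Γ, I_{℘,Γ}), p.128; Prop. 3.6 p.38; joint J1 = GAP-LEDGER-HU row HU-R01 (unrefereed preprint arXiv:2507.21400v1 under adjudication, D-0012/D-0089
— kernel support on OUR typed carriers of row 101; nothing of the source asserted)] -/
theorem quadInvolutionDet_eq_det (n : ℕ) :
    quadInvolutionDet k n = Matrix.det (Matrix.of
      ![![(-bvar k (1, 3, 4)) * (-bvar k (1, 3, 9)),
          -((-bvar k (1, 3, 4)) * bvar k (2, 3, 9) + bvar k (2, 3, 4) * (-bvar k (1, 3, 9))), bvar k (2, 3, 4) * bvar k (2, 3, 9)],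
        ![(-bvar k (1, 3, 5)) * (-bvar k (1, 3, 8)),
          -((-bvar k (1, 3, 5)) * bvar k (2, 3, 8) + bvar k (2, 3, 5) * (-bvar k (1, 3, 8))), bvar k (2, 3, 5) * bvar k (2, 3, 8)],
        ![(-bvar k (1, 3, 6)) * (-bvar k (1, 3, 7)),
          -((-bvar k (1, 3, 6)) * bvar k (2, 3, 7) + bvar k (2, 3, 6) * (-bvar k (1, 3, 7))), bvar k (2, 3, 6) * bvar k (2, 3, 7)]] :
      Matrix (Fin 3) (Fin 3) (BasicRing n k)) := by
  rw [Matrix.det_fin_three]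
  unfold quadInvolutionDet
  simp only [Matrix.of_apply, Matrix.cons_val', Matrix.cons_val_zero, Matrix.cons_val_one, Matrix.cons_val_two,
    Matrix.cons_val_fin_one, Matrix.empty_val', Matrix.head_cons, Matrix.tail_cons, Matrix.head_fin_const]
  ring

/-- The cofactor `c₁` of `det(4,5,6)` in the certificate `f·g = Σ cᵢ·detᵢ` (integer sextic in `x_{13j}, x_{23j}`). OURS.
[cite: Hu2025, Def. 7.1 (Γ-scheme Z_Γ, I_{℘,Γ}), p.128; Prop. 3.6 p.38; joint J1 = GAP-LEDGER-HU row HU-R01 (unrefereed preprint arXiv:2507.21400v1 under adjudication, D-0012/D-0089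
— kernel support on OUR typed carriers of row 101; nothing of the source asserted)] -/
def quadCof1 (n : ℕ) : BasicRing n k :=
    bvar k (1, 3, 7) * bvar k (1, 3, 7) * bvar k (1, 3, 9) * bvar k (2, 3, 4) * bvar k (2, 3, 5) * bvar k (2, 3, 8)
      - bvar k (1, 3, 7) * bvar k (1, 3, 7) * bvar k (1, 3, 8) * bvar k (2, 3, 4) * bvar k (2, 3, 5) * bvar k (2, 3, 9)
      - bvar k (1, 3, 5) * bvar k (1, 3, 7) * bvar k (1, 3, 9) * bvar k (2, 3, 4) * bvar k (2, 3, 7) * bvar k (2, 3, 8)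
      + bvar k (1, 3, 5) * bvar k (1, 3, 7) * bvar k (1, 3, 8) * bvar k (2, 3, 4) * bvar k (2, 3, 7) * bvar k (2, 3, 9)
      - bvar k (1, 3, 4) * bvar k (1, 3, 7) * bvar k (1, 3, 9) * bvar k (2, 3, 5) * bvar k (2, 3, 7) * bvar k (2, 3, 8)
      + bvar k (1, 3, 4) * bvar k (1, 3, 7) * bvar k (1, 3, 8) * bvar k (2, 3, 5) * bvar k (2, 3, 7) * bvar k (2, 3, 9)
      + bvar k (1, 3, 4) * bvar k (1, 3, 5) * bvar k (1, 3, 9) * bvar k (2, 3, 7) * bvar k (2, 3, 7) * bvar k (2, 3, 8)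
      - bvar k (1, 3, 4) * bvar k (1, 3, 5) * bvar k (1, 3, 8) * bvar k (2, 3, 7) * bvar k (2, 3, 7) * bvar k (2, 3, 9)

/-- The cofactor `c₂` of `det(4,7,8)` in the certificate `f·g = Σ cᵢ·detᵢ` (integer sextic in `x_{13j}, x_{23j}`). OURS.
[cite: Hu2025, Def. 7.1 (Γ-scheme Z_Γ, I_{℘,Γ}), p.128; Prop. 3.6 p.38; joint J1 = GAP-LEDGER-HU row HU-R01 (unrefereed preprint arXiv:2507.21400v1 under adjudication, D-0012/D-0089
— kernel support on OUR typed carriers of row 101; nothing of the source asserted)] -/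
def quadCof2 (n : ℕ) : BasicRing n k :=
    -(bvar k (1, 3, 5) * bvar k (1, 3, 7) * bvar k (1, 3, 9) * bvar k (2, 3, 4) * bvar k (2, 3, 5) * bvar k (2, 3, 6))
      + bvar k (1, 3, 5) * bvar k (1, 3, 6) * bvar k (1, 3, 7) * bvar k (2, 3, 4) * bvar k (2, 3, 5) * bvar k (2, 3, 9)
      + bvar k (1, 3, 5) * bvar k (1, 3, 5) * bvar k (1, 3, 9) * bvar k (2, 3, 4) * bvar k (2, 3, 6) * bvar k (2, 3, 7)
      - bvar k (1, 3, 5) * bvar k (1, 3, 5) * bvar k (1, 3, 6) * bvar k (2, 3, 4) * bvar k (2, 3, 7) * bvar k (2, 3, 9)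
      + bvar k (1, 3, 4) * bvar k (1, 3, 7) * bvar k (1, 3, 9) * bvar k (2, 3, 5) * bvar k (2, 3, 5) * bvar k (2, 3, 6)
      - bvar k (1, 3, 4) * bvar k (1, 3, 6) * bvar k (1, 3, 7) * bvar k (2, 3, 5) * bvar k (2, 3, 5) * bvar k (2, 3, 9)
      - bvar k (1, 3, 4) * bvar k (1, 3, 5) * bvar k (1, 3, 9) * bvar k (2, 3, 5) * bvar k (2, 3, 6) * bvar k (2, 3, 7)
      + bvar k (1, 3, 4) * bvar k (1, 3, 5) * bvar k (1, 3, 6) * bvar k (2, 3, 5) * bvar k (2, 3, 7) * bvar k (2, 3, 9)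

/-- The cofactor `c₃` of `det(5,7,9)` in the certificate `f·g = Σ cᵢ·detᵢ` (integer sextic in `x_{13j}, x_{23j}`). OURS.
[cite: Hu2025, Def. 7.1 (Γ-scheme Z_Γ, I_{℘,Γ}), p.128; Prop. 3.6 p.38; joint J1 = GAP-LEDGER-HU row HU-R01 (unrefereed preprint arXiv:2507.21400v1 under adjudication, D-0012/D-0089
— kernel support on OUR typed carriers of row 101; nothing of the source asserted)] -/
def quadCof3 (n : ℕ) : BasicRing n k :=
    bvar k (1, 3, 5) * bvar k (1, 3, 7) * bvar k (1, 3, 8) * bvar k (2, 3, 4) * bvar k (2, 3, 4) * bvar k (2, 3, 6)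
      - bvar k (1, 3, 5) * bvar k (1, 3, 6) * bvar k (1, 3, 7) * bvar k (2, 3, 4) * bvar k (2, 3, 4) * bvar k (2, 3, 8)
      - bvar k (1, 3, 4) * bvar k (1, 3, 7) * bvar k (1, 3, 8) * bvar k (2, 3, 4) * bvar k (2, 3, 5) * bvar k (2, 3, 6)
      + bvar k (1, 3, 4) * bvar k (1, 3, 6) * bvar k (1, 3, 7) * bvar k (2, 3, 4) * bvar k (2, 3, 5) * bvar k (2, 3, 8)
      - bvar k (1, 3, 4) * bvar k (1, 3, 5) * bvar k (1, 3, 8) * bvar k (2, 3, 4) * bvar k (2, 3, 6) * bvar k (2, 3, 7)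
      + bvar k (1, 3, 4) * bvar k (1, 3, 5) * bvar k (1, 3, 6) * bvar k (2, 3, 4) * bvar k (2, 3, 7) * bvar k (2, 3, 8)
      + bvar k (1, 3, 4) * bvar k (1, 3, 4) * bvar k (1, 3, 8) * bvar k (2, 3, 5) * bvar k (2, 3, 6) * bvar k (2, 3, 7)
      - bvar k (1, 3, 4) * bvar k (1, 3, 4) * bvar k (1, 3, 6) * bvar k (2, 3, 5) * bvar k (2, 3, 7) * bvar k (2, 3, 8)

/-- The cofactor `c₄` of `det(6,8,9)` in the certificate `f·g = Σ cᵢ·detᵢ` (integer sextic in `x_{13j}, x_{23j}`). OURS.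
[cite: Hu2025, Def. 7.1 (Γ-scheme Z_Γ, I_{℘,Γ}), p.128; Prop. 3.6 p.38; joint J1 = GAP-LEDGER-HU row HU-R01 (unrefereed preprint arXiv:2507.21400v1 under adjudication, D-0012/D-0089
— kernel support on OUR typed carriers of row 101; nothing of the source asserted)] -/
def quadCof4 (n : ℕ) : BasicRing n k :=
    -(bvar k (1, 3, 5) * bvar k (1, 3, 7) * bvar k (1, 3, 7) * bvar k (2, 3, 4) * bvar k (2, 3, 4) * bvar k (2, 3, 5))
      + bvar k (1, 3, 5) * bvar k (1, 3, 5) * bvar k (1, 3, 7) * bvar k (2, 3, 4) * bvar k (2, 3, 4) * bvar k (2, 3, 7)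
      + bvar k (1, 3, 4) * bvar k (1, 3, 7) * bvar k (1, 3, 7) * bvar k (2, 3, 4) * bvar k (2, 3, 5) * bvar k (2, 3, 5)
      - bvar k (1, 3, 4) * bvar k (1, 3, 5) * bvar k (1, 3, 5) * bvar k (2, 3, 4) * bvar k (2, 3, 7) * bvar k (2, 3, 7)
      - bvar k (1, 3, 4) * bvar k (1, 3, 4) * bvar k (1, 3, 7) * bvar k (2, 3, 5) * bvar k (2, 3, 5) * bvar k (2, 3, 7)
      + bvar k (1, 3, 4) * bvar k (1, 3, 4) * bvar k (1, 3, 5) * bvar k (2, 3, 5) * bvar k (2, 3, 7) * bvar k (2, 3, 7)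

/-- **The certificate**: `det(a₄,a₅,a₇) · g = c₁·det(a₄,a₅,a₆) + c₂·det(a₄,a₇,a₈) + c₃·det(a₅,a₇,a₉) + c₄·det(a₆,a₈,a₉)` in
`k[Var_𝕌]` (an identity of degree-9 polynomials in the 18 basic variables, over every commutative ring).
[cite: Hu2025, Def. 7.1 (Γ-scheme Z_Γ, I_{℘,Γ}), p.128; Prop. 3.6 p.38; joint J1 = GAP-LEDGER-HU row HU-R01 (unrefereed preprint arXiv:2507.21400v1 under adjudication, D-0012/D-0089
— kernel support on OUR typed carriers of row 101; nothing of the source asserted)] -/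
theorem quad_certificate :
    (chartMinor k (4, 5, 7) : BasicRing n k) * quadInvolutionDet k n =
      quadCof1 k n * chartMinor k (4, 5, 6) + quadCof2 k n * chartMinor k (4, 7, 8)
        + quadCof3 k n * chartMinor k (5, 7, 9) + quadCof4 k n * chartMinor k (6, 8, 9) := by
  have h4 : (3 : ℕ) < 4 := by norm_num
  have h5 : (3 : ℕ) < 5 := by norm_num
  have h6 : (3 : ℕ) < 6 := by norm_num
  have h7 : (3 : ℕ) < 7 := by norm_num
  have h8 : (3 : ℕ) < 8 := by norm_num
  have h9 : (3 : ℕ) < 9 := by norm_num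
  rw [chartMinor_explicit k h4 h5 h7, chartMinor_explicit k h4 h5 h6, chartMinor_explicit k h4 h7 h8,
    chartMinor_explicit k h5 h7 h9, chartMinor_explicit k h6 h8 h9]
  unfold quadInvolutionDet quadCof1 quadCof2 quadCof3 quadCof4
  ring

/-- `det(a₄,a₅,a₇) · g ∈ (minors of Γ)`.
[cite: Hu2025, Def. 7.1 (Γ-scheme Z_Γ, I_{℘,Γ}), p.128; Prop. 3.6 p.38; joint J1 = GAP-LEDGER-HU row HU-R01 (unrefereed preprint arXiv:2507.21400v1 under adjudication, D-0012/D-0089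
— kernel support on OUR typed carriers of row 101; nothing of the source asserted)] -/
theorem quad_mul_mem :
    (chartMinor k (4, 5, 7) : BasicRing n k) * quadInvolutionDet k n ∈ gammaMinorIdeal k n quadGamma := by
  rw [quad_certificate]
  have m : ∀ u ∈ quadGamma, (chartMinor k u : BasicRing n k) ∈ gammaMinorIdeal k n quadGamma :=
    fun u hu => Ideal.subset_span ⟨u, hu, rfl⟩
  refine Ideal.add_mem _ (Ideal.add_mem _ (Ideal.add_mem _ ?_ ?_) ?_) ?_ <;>
    refine Ideal.mul_mem_left _ _ (m _ ?_) <;>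
    simp [quadGamma]

/-! ## §3 The two evaluation points (integer coordinates; values of `f`, `g` equal to `1`) -/

/-- Evaluation of `k[Var_𝕌]` at an integer point given as a table on index triples (entries off the table's support, e.g. all
columns `> 9`, evaluate to `0`).
[cite: Hu2025, Def. 7.1 (Γ-scheme Z_Γ, I_{℘,Γ}), p.128; Prop. 3.6 p.38; joint J1 = GAP-LEDGER-HU row HU-R01 (unrefereed preprint arXiv:2507.21400v1 under adjudication, D-0012/D-0089
— kernel support on OUR typed carriers of row 101; nothing of the source asserted)] -/
def evalAt (n : ℕ) (T : ℕ × ℕ × ℕ → ℤ) : BasicRing n k →+* k :=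
  MvPolynomial.eval fun v => (T v.1.1 : k)

/-- `evalAt T` on a basic variable `x_{ijl}` (`1 ≤ i < j ≤ 3 < l ≤ n`) is the table value.
[cite: Hu2025, Def. 7.1 (Γ-scheme Z_Γ, I_{℘,Γ}), p.128; Prop. 3.6 p.38; joint J1 = GAP-LEDGER-HU row HU-R01 (unrefereed preprint arXiv:2507.21400v1 under adjudication, D-0012/D-0089
— kernel support on OUR typed carriers of row 101; nothing of the source asserted)] -/
theorem evalAt_bvar (T : ℕ × ℕ × ℕ → ℤ) {i j l : ℕ} (hi : 1 ≤ i) (hij : i < j) (hj : j ≤ 3) (hl : 3 < l) (hln : l ≤ n) :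
    evalAt k n T (bvar k (i, j, l)) = (T (i, j, l) : k) := by
  have hm : (i, j, l) ∈ plVarSet n := mem_plVarSet hi hij (lt_of_le_of_lt hj hl) hln hl
  have hb : ¬ IsLt (i, j, l) := not_isLt_of_le hi hij hj
  rw [bvar_of_mem k hm hb]
  unfold evalAt
  exact MvPolynomial.eval_X _

/-- **The quadrilateral point `Q`** (lines `z = 0`, `x + z = 0`, `y + z = 0`, `x + y + 3z = 0`; vertices `a_j = Lᵢ × Lⱼ`), as the
table `x_{ijl}(Q)`: `x_{23j} = a_{1j}`, `x_{13j} = −a_{2j}`, `x_{12j} = a_{3j}`. All four Γ-minors vanish at `Q` and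
`det(a₄,a₅,a₇)(Q) = 1`. OURS.
[cite: Hu2025, Def. 7.1 (Γ-scheme Z_Γ, I_{℘,Γ}), p.128; Prop. 3.6 p.38; joint J1 = GAP-LEDGER-HU row HU-R01 (unrefereed preprint arXiv:2507.21400v1 under adjudication, D-0012/D-0089
— kernel support on OUR typed carriers of row 101; nothing of the source asserted)] -/
def quadPointQ (t : ℕ × ℕ × ℕ) : ℤ :=
  if t = (1, 2, 7) then 1 else if t = (1, 2, 8) then 1 else if t = (1, 2, 9) then -1
  else if t = (1, 3, 4) then -1 else if t = (1, 3, 6) then -1 else if t = (1, 3, 7) then 1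
  else if t = (1, 3, 8) then 2 else if t = (1, 3, 9) then -1
  else if t = (2, 3, 5) then -1 else if t = (2, 3, 6) then -1 else if t = (2, 3, 7) then -1
  else if t = (2, 3, 8) then -1 else if t = (2, 3, 9) then 2 else 0

/-- **The coplanar point `P`** (`a_{3j} = x_{12j} = 0` for all `j`, so every `3 × 3` minor on columns `> 3` vanishes; the twelve
`x_{13j}, x_{23j}` chosen with `g(P) = 1`). OURS.
[cite: Hu2025, Def. 7.1 (Γ-scheme Z_Γ, I_{℘,Γ}), p.128; Prop. 3.6 p.38; joint J1 = GAP-LEDGER-HU row HU-R01 (unrefereed preprint arXiv:2507.21400v1 under adjudication, D-0012/D-0089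
— kernel support on OUR typed carriers of row 101; nothing of the source asserted)] -/
def quadPointP (t : ℕ × ℕ × ℕ) : ℤ :=
  if t = (1, 3, 4) then -1 else if t = (1, 3, 5) then 1 else if t = (1, 3, 6) then -1
  else if t = (1, 3, 7) then 1 else if t = (1, 3, 8) then 1
  else if t = (2, 3, 5) then 1 else if t = (2, 3, 8) then -1 else if t = (2, 3, 9) then -1 else 0

/-- The Γ-minors vanish at `Q` (`n ≥ 9`).
[cite: Hu2025, Def. 7.1 (Γ-scheme Z_Γ, I_{℘,Γ}), p.128; Prop. 3.6 p.38; joint J1 = GAP-LEDGER-HU row HU-R01 (unrefereed preprint arXiv:2507.21400v1 under adjudication, D-0012/D-0089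
— kernel support on OUR typed carriers of row 101; nothing of the source asserted)] -/
theorem evalQ_gamma (hn : 9 ≤ n) : ∀ u ∈ quadGamma, evalAt k n quadPointQ (chartMinor k u) = 0 := by
  intro u hu
  simp only [quadGamma, Set.mem_insert_iff, Set.mem_singleton_iff] at hu
  rcases hu with rfl | rfl | rfl | rfl <;>
  · rw [chartMinor_explicit k (by norm_num) (by norm_num) (by norm_num)]
    simp (disch := omega) only [map_add, map_sub, map_mul, evalAt_bvar]
    norm_num [quadPointQ]

/-- `det(a₄,a₅,a₇)(Q) = 1` (`n ≥ 9`).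
[cite: Hu2025, Def. 7.1 (Γ-scheme Z_Γ, I_{℘,Γ}), p.128; Prop. 3.6 p.38; joint J1 = GAP-LEDGER-HU row HU-R01 (unrefereed preprint arXiv:2507.21400v1 under adjudication, D-0012/D-0089
— kernel support on OUR typed carriers of row 101; nothing of the source asserted)] -/
theorem evalQ_f (hn : 9 ≤ n) : evalAt k n quadPointQ (chartMinor k (4, 5, 7)) = 1 := by
  rw [chartMinor_explicit k (by norm_num) (by norm_num) (by norm_num)]
  simp (disch := omega) only [map_add, map_sub, map_mul, evalAt_bvar]
  norm_num [quadPointQ]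

/-- The Γ-minors vanish at `P` (`n ≥ 9`).
[cite: Hu2025, Def. 7.1 (Γ-scheme Z_Γ, I_{℘,Γ}), p.128; Prop. 3.6 p.38; joint J1 = GAP-LEDGER-HU row HU-R01 (unrefereed preprint arXiv:2507.21400v1 under adjudication, D-0012/D-0089
— kernel support on OUR typed carriers of row 101; nothing of the source asserted)] -/
theorem evalP_gamma (hn : 9 ≤ n) : ∀ u ∈ quadGamma, evalAt k n quadPointP (chartMinor k u) = 0 := by
  intro u hu
  simp only [quadGamma, Set.mem_insert_iff, Set.mem_singleton_iff] at hu
  rcases hu with rfl | rfl | rfl | rfl <;>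
  · rw [chartMinor_explicit k (by norm_num) (by norm_num) (by norm_num)]
    simp (disch := omega) only [map_add, map_sub, map_mul, evalAt_bvar]
    norm_num [quadPointP]

/-- `g(P) = 1` (`n ≥ 9`).
[cite: Hu2025, Def. 7.1 (Γ-scheme Z_Γ, I_{℘,Γ}), p.128; Prop. 3.6 p.38; joint J1 = GAP-LEDGER-HU row HU-R01 (unrefereed preprint arXiv:2507.21400v1 under adjudication, D-0012/D-0089
— kernel support on OUR typed carriers of row 101; nothing of the source asserted)] -/
theorem evalP_g (hn : 9 ≤ n) : evalAt k n quadPointP (quadInvolutionDet k n) = 1 := by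
  unfold quadInvolutionDet
  simp (disch := omega) only [map_add, map_sub, map_mul, evalAt_bvar]
  norm_num [quadPointP]

/-! ## §4 The Γ-ideal of the quadrilateral is not prime; the chart ring of `Z_Γ` is not a domain -/

/-- `det(a₄,a₅,a₇) ∉ (minors of Γ)` (nontrivial `k`, `n ≥ 9`).
[cite: Hu2025, Def. 7.1 (Γ-scheme Z_Γ, I_{℘,Γ}), p.128; Prop. 3.6 p.38; joint J1 = GAP-LEDGER-HU row HU-R01 (unrefereed preprint arXiv:2507.21400v1 under adjudication, D-0012/D-0089
— kernel support on OUR typed carriers of row 101; nothing of the source asserted)] -/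
theorem chartMinor457_not_mem [Nontrivial k] (hn : 9 ≤ n) :
    (chartMinor k (4, 5, 7) : BasicRing n k) ∉ gammaMinorIdeal k n quadGamma := by
  refine not_mem_span_of_eval (evalAt k n quadPointQ) ?_ ?_
  · rintro _ ⟨u, hu, rfl⟩
    exact evalQ_gamma k hn u hu
  · rw [evalQ_f k hn]
    exact one_ne_zero

/-- `g ∉ (minors of Γ)` (nontrivial `k`, `n ≥ 9`).
[cite: Hu2025, Def. 7.1 (Γ-scheme Z_Γ, I_{℘,Γ}), p.128; Prop. 3.6 p.38; joint J1 = GAP-LEDGER-HU row HU-R01 (unrefereed preprint arXiv:2507.21400v1 under adjudication, D-0012/D-0089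
— kernel support on OUR typed carriers of row 101; nothing of the source asserted)] -/
theorem quadInvolutionDet_not_mem [Nontrivial k] (hn : 9 ≤ n) : quadInvolutionDet k n ∉ gammaMinorIdeal k n quadGamma := by
  refine not_mem_span_of_eval (evalAt k n quadPointP) ?_ ?_
  · rintro _ ⟨u, hu, rfl⟩
    exact evalP_gamma k hn u hu
  · rw [evalP_g k hn]
    exact one_ne_zero

/-- **The Γ-ideal `(𝓕_m) + (x̄_u : u ∈ Γ)` of the complete quadrilateral in `k[x_u]_{u ∈ 𝕀_{3,n} ∖ m}`, `n ≥ 9`, is NOT PRIME** (every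
nontrivial commutative ring `k`): `x̄_{457} · basicIncl g` lies in it, neither factor does.
[cite: Hu2025, Def. 7.1 (Γ-scheme Z_Γ, I_{℘,Γ}), p.128; Prop. 3.6 p.38; joint J1 = GAP-LEDGER-HU row HU-R01 (unrefereed preprint arXiv:2507.21400v1 under adjudication, D-0012/D-0089
— kernel support on OUR typed carriers of row 101; nothing of the source asserted)] -/
theorem not_isPrime_gammaChartIdeal_quad [Nontrivial k] (hn : 9 ≤ n) : ¬ (gammaChartIdeal k n quadGamma).IsPrime := by
  intro hP
  have h457 : ((4 : ℕ), (5 : ℕ), (7 : ℕ)) ∈ plVarSet n :=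
    mem_plVarSet (by norm_num) (by norm_num) (by norm_num) (by omega) (by norm_num)
  have hFG : xbar k (4, 5, 7) * basicIncl n k (quadInvolutionDet k n) ∈ gammaChartIdeal k n quadGamma := by
    rw [mem_gammaChartIdeal_iff k (quadGamma_subset hn), map_mul, chartParam_xbar k h457, chartParam_basicIncl]
    exact quad_mul_mem k
  rcases hP.mem_or_mem hFG with hF | hG
  · rw [mem_gammaChartIdeal_iff k (quadGamma_subset hn), chartParam_xbar k h457] at hF
    exact chartMinor457_not_mem k hn hF
  · rw [mem_gammaChartIdeal_iff k (quadGamma_subset hn), chartParam_basicIncl] at hG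
    exact quadInvolutionDet_not_mem k hn hG

/-- **The chart ring of the Γ-scheme of the complete quadrilateral, `k[x_u]_{u ∈ 𝕀_{3,n} ∖ m} ⧸ ((𝓕_m) + (x̄_u : u ∈ Γ))`, is NOT A
DOMAIN** for every `n ≥ 9` and every nontrivial commutative ring `k` (in particular over `ℤ` and over every field) — the typed form of
«`Z_Γ` is not integral» for `Γ = {456, 478, 579, 689}`. Evidence for joint J1 / GAP-LEDGER-HU row HU-R01 about the INFERENCE «X
integral ⇒ Z_Γ integral»; it says nothing about [Hu2025] Thm 1.3/8.5, whose hypothesis «Z_Γ integral» simply fails for this Γ.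
[cite: Hu2025, Def. 7.1 (Γ-scheme Z_Γ, I_{℘,Γ}), p.128; Prop. 3.6 p.38; joint J1 = GAP-LEDGER-HU row HU-R01 (unrefereed preprint arXiv:2507.21400v1 under adjudication, D-0012/D-0089
— kernel support on OUR typed carriers of row 101; nothing of the source asserted)] -/
theorem not_isDomain_gammaChart_quad [Nontrivial k] (hn : 9 ≤ n) :
    ¬ IsDomain (ChartRing n k ⧸ gammaChartIdeal k n quadGamma) := by
  intro h
  exact not_isPrime_gammaChartIdeal_quad k hn ((Ideal.Quotient.isDomain_iff_prime _).mp h)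

/-- The case `n = 9` (`Gr(3,9)`, the tree certificate's instance).
[cite: Hu2025, Def. 7.1 (Γ-scheme Z_Γ, I_{℘,Γ}), p.128; Prop. 3.6 p.38; joint J1 = GAP-LEDGER-HU row HU-R01 (unrefereed preprint arXiv:2507.21400v1 under adjudication, D-0012/D-0089
— kernel support on OUR typed carriers of row 101; nothing of the source asserted)] -/
theorem not_isDomain_gammaChart_quad_nine [Nontrivial k] :
    ¬ IsDomain (ChartRing 9 k ⧸ gammaChartIdeal k 9 quadGamma) :=
  not_isDomain_gammaChart_quad k le_rfl

end Literature.AlgebraicGeometry.Hu2025.Statements.S03Pluecker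

end
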